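import Summits.PneNP.PneNP.Theses.LatticeMagic

/-!
# Route LatticeMagic — assembly item `Assembly` (stmt-PneNP-10711)

Route `PneNP/LatticeMagic`, item stmt-PneNP-10711 (`Assembly`, rank 1, rev 2 "honest bookkeeping
form"):

  `GapCVPInPromiseNP → ModelBridge → Target → PneNP`.

Proof (the body of the route's kernel-checked deciding theorem
`Summit.PneNP.PneNP.Theses.LatticeMagic.closes`, without its unused rung hypotheses): suppose
`¬ PneNP`, i.e. every language of Cook's `NP` over `{0,1}` lies in Cook's `P`. `Target` gives a
constant `c ≥ 1` with `GapCVP_c ∉ PromiseCoNP`; `GapCVPInPromiseNP` at `γ ≡ c` gives an `NP`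
language `L` containing the code of every YES-instance and of no NO-instance. By the model bridge
`L ∈ PNPWave0.NP Bool`, hence `L ∈ PNPWave0.P Bool = Classes.P = co P`
(`Literature.Computability.Complexity.co_P_holds`), so `Lᶜ ∈ P ⊆ NP`
(`Literature.Computability.Complexity.P_subset_NP_holds`), i.e. `L ∈ coNP` separates `GapCVP_c`:
`GapCVP_c ∈ PromiseCoNP`, a contradiction.

References: D. Aharonov, O. Regev, *Lattice problems in NP ∩ coNP*, J. ACM 52 (2005), §1;
D. Micciancio, S. Goldwasser, *Complexity of Lattice Problems* (2002), Ch. 1 §1.2; S. Cook,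
*The P versus NP problem*, Clay Mathematics Institute (2006), §1.
-/

namespace Summit.PneNP.PneNP.Theorems

/-- **Assembly of route LatticeMagic** (item stmt-PneNP-10711):
`GapCVPInPromiseNP → ModelBridge → Target → PneNP`. If `P = NP` in Cook's model then, through the
model bridge, the `NP` separator `L` of `GapCVP_c` (from `GapCVPInPromiseNP` at the constant factor
`c` supplied by `Target`) lies in `Classes.P = co P`, so `Lᶜ ∈ P ⊆ NP`, i.e. `L ∈ coNP` and
`GapCVP_c ∈ PromiseCoNP`, contradicting `Target`. [AharonovRegev2005, §1 p. 2;
MicciancioGoldwasser2002, Ch. 1 §1.2; CookClay2006, §1] -/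
theorem latticeMagic_assembly_proof :
    Summit.PneNP.PneNP.Theses.LatticeMagic.Assembly := by
  unfold Summit.PneNP.PneNP.Theses.LatticeMagic.Assembly
  intro hNP hB hT
  obtain ⟨c, hc, hnot⟩ := hT
  obtain ⟨hPeq, hNPeq⟩ := hB
  by_contra hne
  apply hnot
  obtain ⟨L, hL, hyes, hno⟩ := hNP (fun _ => c) (fun _ => hc)
  have hL0 : L ∈ Literature.Computability.Complexity.PNPWave0.NP Bool := by
    rw [hNPeq]; exact hL
  have hLP0 : L ∈ Literature.Computability.Complexity.PNPWave0.P Bool := by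
    by_contra hLP0
    exact hne ⟨L, hL0, hLP0⟩
  have hLP : L ∈ Literature.Computability.Complexity.Classes.P := by
    rw [← hPeq]; exact hLP0
  have hLcP : Lᶜ ∈ Literature.Computability.Complexity.Classes.P := by
    have h : L ∈ Literature.Computability.Complexity.co
        Literature.Computability.Complexity.Classes.P := by
      rw [Literature.Computability.Complexity.co_P_holds]; exact hLP
    exact h
  have hLcoNP : L ∈ Literature.Computability.Complexity.coNP := by
    show Lᶜ ∈ Literature.Computability.Complexity.Nondeterministic.NP
    exact Literature.Computability.Complexity.P_subset_NP_holds hLcP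
  exact ⟨L, hLcoNP, hyes, hno⟩

end Summit.PneNP.PneNP.Theorems
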